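import Mathlib
import Summits.KontsevichZagierPeriods.Zeta5Search.BigPrimeWindow
import Summits.KontsevichZagierPeriods.Zeta5Search.ValuationLawsBelowB0
import Summits.KontsevichZagierPeriods.Zeta5Search.DualSeriesScaling
import HarnessLib

/-!
# ζ(5) search — the law (WV) is a THEOREM at every prime `p ≥ max(7, b₀ + 1 − b₍₂₎ − b₍₃₎)`

Cell `pub-zeta5` (HONEST FRAMING: systematic search; no irrationality claim unless certified), typer seat
generation 7.  Final form of the typer's (WV) results: with the two-level support bookkeeping of
`BigPrimeSupport2`, the coefficients `W(b)`, `U(b)` are `p`-integral for every prime with `b₀ + 1 ≤ p + b_{j₂} + b_{j₃}`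
(`padicNorm_coeff_le_one_of_slots`), and together with `BigPrimeWindow.one_le_padicValRat_coeffW_of_slots` the
OBSERVED law (WV) of `CasoratianValuation.lean` holds at every prime `p ≥ max(7, b₀ + 1 − b_{j₂} − b_{j₃})`
(`zeta3CoefficientValuationLaw_of_slots`).  With the optimal slots this leaves (WV) OBSERVED exactly for
`5 ≤ p ≤ b₀ − b₍₂₎ − b₍₃₎` (where the pair floors avoiding the minimal slot are non-zero) and at `p = 5` below `b₀`.
OUR theorems; coefficient arithmetic only.
-/

noncomputable section

open Finset

namespace Summit.KontsevichZagierPeriods.Zeta5Search.BigPrime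

open Summit.KontsevichZagierPeriods.Zeta5Search.DualSeries (InBox)
open Summit.KontsevichZagierPeriods.Zeta5Search.WedgeDictionary (IsPFData coeffU coeffW coeffU_eq coeffW_eq
  exists_isPFData dOf)
open Summit.KontsevichZagierPeriods.Zeta5Search.CasoratianValuation (InPolytope refundW pairFloors topPartners)

section Integral2

variable {p : ℕ} [hp : Fact p.Prime]

/-- For `b₀ + 1 ≤ p + b_{j₂} + b_{j₃}` every partial-fraction coefficient of order `≥ 2` is `p`-integral. -/
theorem padicNorm_pf_le_one_of_slots (b : ℕ → ℤ) (hb : InBox b) (hhalf : ∀ j ∈ range 7, 2 * b (j + 1) ≤ b 0 + 1)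
    {c : ℕ → ℕ → ℚ} (hc : IsPFData b c) {j₁ j₂ j₃ : ℕ} (hj₁ : j₁ ∈ range 7) (hj₂ : j₂ ∈ (range 7).erase j₁)
    (h23 : (b (j₂ + 1)).toNat ≤ (b (j₃ + 1)).toNat)
    (hmin : ∀ j ∈ ((range 7).erase j₁).erase j₂, (b (j₃ + 1)).toNat ≤ (b (j + 1)).toNat)
    (hT : (b 0).toNat + 1 ≤ p + (b (j₂ + 1)).toNat + (b (j₃ + 1)).toNat) {q : ℕ} (hq : q ≤ (b 0).toNat)
    {o : ℕ} (ho1 : 1 ≤ o) (ho : o < 6) : padicNorm p (c o q) ≤ 1 := by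
  have hmin2 : ∀ j ∈ range 7, j ≠ j₁ → (b (j₂ + 1)).toNat ≤ (b (j + 1)).toNat := by
    intro j hj hne
    by_cases hj2 : j = j₂
    · rw [hj2]
    · exact h23.trans (hmin j (mem_erase.2 ⟨hj2, mem_erase.2 ⟨hne, hj⟩⟩))
  by_cases hqS : q ∈ block (b 0).toNat (b (j₃ + 1)).toNat
  · have h := pf_coeff_eq2 b hb hhalf hc hj₁ hj₂ h23 hmin hqS ho
    have hu : ¬ (p : ℤ) ∣ e20 (b 0).toNat (fun j => (b (j + 1)).toNat) j₂ j₃ q ^ 6 := fun hd =>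
      not_dvd_e20 (β := fun j => (b (j + 1)).toNat) hp.out hT h23 hqS
        ((Nat.prime_iff_prime_int.1 hp.out).dvd_of_dvd_pow hd)
    exact padicNorm_le_one_of_mul_eq hu (by push_cast; exact h)
  · by_cases hq2 : q ∈ block (b 0).toNat (b (j₂ + 1)).toNat
    · rw [pf_eq_zero_of_mem_rim b hb hhalf hc hj₁ hj₂ h23 hmin (by rw [rim, mem_sdiff]; exact ⟨hq2, hqS⟩) ho1 ho,
        padicNorm.zero]
      exact zero_le_one
    · rw [pf_eq_zero_of_not_mem b hb hhalf hc hj₁ hmin2 hq hq2 ho, padicNorm.zero]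
      exact zero_le_one

/-- **`W(b)`, `U(b)` are `p`-integral for every prime with `b₀ + 1 ≤ p + b_{j₂} + b_{j₃}`.** -/
theorem padicNorm_coeff_le_one_of_slots (b : ℕ → ℤ) (j₁ j₂ j₃ : ℕ) (hb : InBox b)
    (h2 : ∀ i ∈ range 7, 2 * b (i + 1) ≤ b 0) (h3 : ∑ i ∈ range 7, b (i + 1) ≤ 3 * b 0)
    (hj₁ : j₁ ∈ range 7) (hj₂ : j₂ ∈ range 7) (hj₃ : j₃ ∈ range 7) (h12 : j₂ ≠ j₁)
    (hle : b (j₂ + 1) ≤ b (j₃ + 1)) (hmin : ∀ j ∈ range 7, j ≠ j₁ → j ≠ j₂ → b (j₃ + 1) ≤ b (j + 1))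
    (hpT : b 0 + 1 ≤ (p : ℤ) + b (j₂ + 1) + b (j₃ + 1)) :
    padicNorm p (coeffW b) ≤ 1 ∧ padicNorm p (coeffU b) ≤ 1 := by
  have h0 : 0 ≤ b 0 := hb.1
  have hj₂' : j₂ ∈ (range 7).erase j₁ := mem_erase.2 ⟨h12, hj₂⟩
  have h02 : 0 ≤ b (j₂ + 1) := (hb.2 j₂ hj₂).1
  have h03 : 0 ≤ b (j₃ + 1) := (hb.2 j₃ hj₃).1
  have e2 : (b (j₂ + 1) : ℤ) = ((b (j₂ + 1)).toNat : ℤ) := (Int.toNat_of_nonneg h02).symm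
  have e3 : (b (j₃ + 1) : ℤ) = ((b (j₃ + 1)).toNat : ℤ) := (Int.toNat_of_nonneg h03).symm
  have h23 : (b (j₂ + 1)).toNat ≤ (b (j₃ + 1)).toNat := Int.toNat_le_toNat hle
  have hmin' : ∀ j ∈ ((range 7).erase j₁).erase j₂, (b (j₃ + 1)).toNat ≤ (b (j + 1)).toNat := by
    intro j hj
    have hj' := mem_erase.1 hj; have hj'' := mem_erase.1 hj'.2
    exact Int.toNat_le_toNat (hmin j hj''.2 hj''.1 hj'.1)
  have hT' : (b 0).toNat + 1 ≤ p + (b (j₂ + 1)).toNat + (b (j₃ + 1)).toNat := by omega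
  have hhalf : ∀ j ∈ range 7, 2 * b (j + 1) ≤ b 0 + 1 := fun j hj => by have := h2 j hj; omega
  obtain ⟨c, hc⟩ := exists_isPFData b hb (by omega)
  have hcq : ∀ q ∈ range ((b 0).toNat + 1), ∀ o, 1 ≤ o → o < 6 → padicNorm p (c o q) ≤ 1 := fun q hq o ho1 ho =>
    padicNorm_pf_le_one_of_slots b hb hhalf hc hj₁ hj₂' h23 hmin' hT' (Nat.lt_succ_iff.1 (mem_range.1 hq)) ho1 ho
  refine ⟨?_, ?_⟩
  · rw [coeffW_eq hc]
    exact padicNorm.sum_le' (fun q hq => hcq q hq 2 (by norm_num) (by norm_num)) zero_le_one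
  · rw [coeffU_eq hc]
    exact padicNorm.sum_le' (fun q hq => hcq q hq 4 (by norm_num) (by norm_num)) zero_le_one

end Integral2

/-- **(WV) holds at every prime `p ≥ max(7, b₀ + 1 − b_{j₂} − b_{j₃})`** (slots as in `BigPrimeWindow`). -/
theorem zeta3CoefficientValuationLaw_of_slots (b : ℕ → ℤ) (p j₁ j₂ j₃ : ℕ) (hb : InPolytope b)
    (hj₁ : j₁ ∈ range 7) (hj₂ : j₂ ∈ range 7) (hj₃ : j₃ ∈ range 7) (h12 : j₂ ≠ j₁)
    (hle : b (j₂ + 1) ≤ b (j₃ + 1)) (hmin : ∀ j ∈ range 7, j ≠ j₁ → j ≠ j₂ → b (j₃ + 1) ≤ b (j + 1))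
    (hprime : p.Prime) (hp7 : 7 ≤ p) (hpT : b 0 + 1 ≤ (p : ℤ) + b (j₂ + 1) + b (j₃ + 1)) (hW : coeffW b ≠ 0) :
    refundW b p + topPartners b p - pairFloors b p ≤ padicValRat p (coeffW b) := by
  haveI : Fact p.Prime := ⟨hprime⟩
  have htp := topPartners_le_pairFloors b hb hprime.pos
  have hv : refundW b p ≤ padicValRat p (coeffW b) := by
    rcases le_or_gt (p : ℤ) (dOf b + 1) with hin | hout
    · rw [refundW_eq_one b hprime.pos hin]
      exact one_le_padicValRat_coeffW_of_slots b p j₁ j₂ j₃ hb.1 hb.2.1 hb.2.2 hj₁ hj₂ hj₃ h12 hle hmin hprime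
        hp7 hpT hin hW
    · rw [refundW_eq_zero b hb hout]
      obtain ⟨hWn, -⟩ := padicNorm_coeff_le_one_of_slots (p := p) b j₁ j₂ j₃ hb.1 hb.2.1 hb.2.2 hj₁ hj₂ hj₃ h12
        hle hmin hpT
      exact padicValRat_nonneg_of_padicNorm_le_one hW hWn
  omega

/-! ### Census-facing form: parameters listed in non-increasing order -/

/-- **(W∞), full window, for SORTED parameters** (`b₆ ≤ b₅ ≤ b₁,…,b₄`; `b₇` arbitrary — it is the dropped slot), as in
the census tables `b₁ ≥ ⋯ ≥ b₇`: every prime `max(7, b₀ + 1 − b₅ − b₆) ≤ p ≤ d(b) + 1` divides `W(b)`.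
(Record ray `(41; 17,16,15,14,13,12,11)·m`: `b₅ + b₆ = 25m`, window `(16m, 25m+1]`.) -/
theorem one_le_padicValRat_coeffW_sorted (b : ℕ → ℤ) (p : ℕ) (hb : InPolytope b)
    (hsort : ∀ j ∈ range 4, b 5 ≤ b (j + 1)) (h65 : b 6 ≤ b 5) (hprime : p.Prime) (hp7 : 7 ≤ p)
    (hpT : b 0 + 1 ≤ (p : ℤ) + b 6 + b 5) (hpd : (p : ℤ) ≤ dOf b + 1) (hW : coeffW b ≠ 0) :
    1 ≤ padicValRat p (coeffW b) := by
  refine one_le_padicValRat_coeffW_of_slots b p 6 5 4 hb.1 hb.2.1 hb.2.2 (by simp) (by simp) (by simp) (by norm_num)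
    h65 (fun j hj h1 h2 => ?_) hprime hp7 hpT hpd hW
  have hj' := mem_range.1 hj
  interval_cases j
  · exact hsort 0 (by simp)
  · exact hsort 1 (by simp)
  · exact hsort 2 (by simp)
  · exact hsort 3 (by simp)
  · exact le_rfl
  · exact absurd rfl h2
  · exact absurd rfl h1

/-- **(U∞), full window, for SORTED parameters**: same ordering, `p ≥ 5`, `2p ≤ d(b)+1` ⟹ `p ∣ U(b)`. -/
theorem one_le_padicValRat_coeffU_sorted (b : ℕ → ℤ) (p : ℕ) (hb : InPolytope b)
    (hsort : ∀ j ∈ range 4, b 5 ≤ b (j + 1)) (h65 : b 6 ≤ b 5) (hprime : p.Prime) (hp5 : 5 ≤ p)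
    (hpT : b 0 + 1 ≤ (p : ℤ) + b 6 + b 5) (hpd : 2 * (p : ℤ) ≤ dOf b + 1) (hU : coeffU b ≠ 0) :
    1 ≤ padicValRat p (coeffU b) := by
  refine one_le_padicValRat_coeffU_of_slots b p 6 5 4 hb.1 hb.2.1 hb.2.2 (by simp) (by simp) (by simp) (by norm_num)
    h65 (fun j hj h1 h2 => ?_) hprime hp5 hpT hpd hU
  have hj' := mem_range.1 hj
  interval_cases j
  · exact hsort 0 (by simp)
  · exact hsort 1 (by simp)
  · exact hsort 2 (by simp)
  · exact hsort 3 (by simp)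
  · exact le_rfl
  · exact absurd rfl h2
  · exact absurd rfl h1

/-! ### Brown–Zudilin's record ray -/

section Record

open Literature.NumberTheory.Irrationality.BrownZudilin2022 (bOfA recordVec)
open Summit.KontsevichZagierPeriods.Zeta5Search.WedgeDictionary (bOfA_nsmul)

/-- The dual parameters of the record direction: `b(a) = (41; 17,16,15,14,13,12,11)` for `a = (8,16,10,15,12,16,18,13)`. -/
theorem bOfA_recordVec_values :
    bOfA recordVec 0 = 41 ∧ bOfA recordVec 1 = 17 ∧ bOfA recordVec 2 = 16 ∧ bOfA recordVec 3 = 15 ∧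
      bOfA recordVec 4 = 14 ∧ bOfA recordVec 5 = 13 ∧ bOfA recordVec 6 = 12 ∧ bOfA recordVec 7 = 11 := by
  refine ⟨?_, ?_, ?_, ?_, ?_, ?_, ?_, ?_⟩ <;> decide

/-- **On Brown–Zudilin's record ray every prime in `(16n, 25n+1]` (`p ≥ 7`) divides the ζ(3)-coefficient `W(b(n·a))`**,
`a = (8,16,10,15,12,16,18,13)`, `b(n·a) = n·(41;17,16,15,14,13,12,11)`, `d = 25n`.  (n = 1: 17, 19, 23; n = 2: 37, 41, 43, 47 —
gen-2 g6 checked these exactly.)  A numerator property of the ζ(3)-coefficient; it moves no margin of the record construction. -/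
theorem record_ray_prime_dvd_coeffW (n p : ℕ) (hn : 1 ≤ n) (hprime : p.Prime) (hp7 : 7 ≤ p)
    (hlo : 16 * n + 1 ≤ p) (hhi : p ≤ 25 * n + 1) (hW : coeffW (bOfA fun i => (n : ℤ) * recordVec i) ≠ 0) :
    1 ≤ padicValRat p (coeffW (bOfA fun i => (n : ℤ) * recordVec i)) := by
  obtain ⟨v0, v1, v2, v3, v4, v5, v6, v7⟩ := bOfA_recordVec_values
  have hb : ∀ j, bOfA (fun i => (n : ℤ) * recordVec i) j = (n : ℤ) * bOfA recordVec j := fun j => bOfA_nsmul n recordVec j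
  have hb0 : bOfA (fun i => (n : ℤ) * recordVec i) 0 = 41 * n := by rw [hb, v0]; ring
  have hb1 : bOfA (fun i => (n : ℤ) * recordVec i) 1 = 17 * n := by rw [hb, v1]; ring
  have hb2 : bOfA (fun i => (n : ℤ) * recordVec i) 2 = 16 * n := by rw [hb, v2]; ring
  have hb3 : bOfA (fun i => (n : ℤ) * recordVec i) 3 = 15 * n := by rw [hb, v3]; ring
  have hb4 : bOfA (fun i => (n : ℤ) * recordVec i) 4 = 14 * n := by rw [hb, v4]; ring
  have hb5 : bOfA (fun i => (n : ℤ) * recordVec i) 5 = 13 * n := by rw [hb, v5]; ring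
  have hb6 : bOfA (fun i => (n : ℤ) * recordVec i) 6 = 12 * n := by rw [hb, v6]; ring
  have hb7 : bOfA (fun i => (n : ℤ) * recordVec i) 7 = 11 * n := by rw [hb, v7]; ring
  have hsum : ∑ j ∈ range 7, bOfA (fun i => (n : ℤ) * recordVec i) (j + 1) = 98 * n := by
    simp only [sum_range_succ, sum_range_zero, hb1, hb2, hb3, hb4, hb5, hb6, hb7]; ring
  have hpoly : InPolytope (bOfA fun i => (n : ℤ) * recordVec i) := by
    refine ⟨⟨by rw [hb0]; positivity, fun j hj => ?_⟩, fun j hj => ?_, by rw [hsum, hb0]; omega⟩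
    · have hj' := mem_range.1 hj
      interval_cases j <;> simp only [hb0, hb1, hb2, hb3, hb4, hb5, hb6, hb7] <;> omega
    · have hj' := mem_range.1 hj
      interval_cases j <;> simp only [hb0, hb1, hb2, hb3, hb4, hb5, hb6, hb7] <;> omega
  have hd : dOf (bOfA fun i => (n : ℤ) * recordVec i) = 25 * n := by rw [dOf, hsum, hb0]; ring
  refine one_le_padicValRat_coeffW_sorted _ p hpoly (fun j hj => ?_) (by rw [hb6, hb5]; omega) hprime hp7
    (by rw [hb0, hb6, hb5]; omega) (by rw [hd]; omega) hW
  have hj' := mem_range.1 hj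
  interval_cases j <;> simp only [hb1, hb2, hb3, hb4, hb5] <;> omega

end Record

end Summit.KontsevichZagierPeriods.Zeta5Search.BigPrime

end
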